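import Literature.NumberTheory.EllipticCurves.TianYuanZhang2017.CMPointClassFieldDisplays
import HarnessLib

/-!
# The class-field split of `CMPointGaloisDisplays` is CONSERVATIVE: the five genus-theory / ring-class-field conjuncts
# (G2 at `d ≡ 5`), (G3b), (G4b), (G5a), (G9) are KERNEL THEOREMS of the printed sentences of `CMPointClassFieldDisplays`

Companion (proofs only; no definition, nothing displayed) to `CMPointClassFieldDisplays.lean`.  For square-free `n`,
`GenusPointData.CMPointClassFieldPrinted D ⟹ GenusPointData.CMPointGaloisPrinted D`
(`cmPointGaloisPrinted_of_classFieldPrinted`), hence `tyz_cmPointClassFieldData ⟹ tyz_cmPointGaloisData ⟹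
tyz_genusPointData`, so every consumer of the latter two (the cell `bsd-monsky`'s route-B doors
`Summits/BirchSwinnertonDyer/Rank1Residual/P2/CongruentNumberSilentEvenFiveThetaCMGalois.lean`, …) runs on the split
display unchanged.  The derivations: (G4b) «`Gal(ℍ′_n/H_d)` fixes `√−d` and every `√(d′*)`» from «`L_d ⊂ H_d`» (J759) and
Cox's Theorem 6.1 (ii) by `√(d′*) = ±∏_{p ∣ d′} √(p*)` (`prod_genusRoot_sq`; `(d₁d₂)* = d₁*d₂*` is the multiplicativity
of `χ₄`); (G2 at `d ≡ 5`) «`Φ₀` trivial on `L_d(i)`» likewise from «`Φ₀` fixes `L_d`», with `i` fixed because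
`√(d*) = i·√−d` for `d ≡ 1 (mod 4)`; (G3b) «`H′_d/ℚ` Galois» and (G5a) «`c` inverts `Gal(H′_d/K_d)`» from Cox's Theorem
9.18 at `L = H′_d` (Abelian over `K_d`, containing `K_d`, inside the ring class field of conductor `4` by Prop. 3.2
(1)(2)) and `c² = 1`; (G9) from Theorem 6.1 (ii) read right to left.  Origin: cell `bsd-monsky`, prover-B seat g12.

References: [TianYuanZhang2017] §3.1 (J738–J739), Prop. 3.2, Thm. 3.6 (J741), proof of Lemma 3.21 (J759), §2.1 (J725);
[Cox2013] (5.12), Theorem 6.1 (ii), Lemma 9.3, Theorem 9.18.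
-/

noncomputable section

open scoped Classical

open WeierstrassCurve Finset

namespace Literature.NumberTheory.EllipticCurves.TianYuanZhang2017

namespace GenusPointData

variable {n : ℕ}

/-! ## §1 Kernel lemmas: `d_K`, `√(d′*) = ±∏_{p ∣ d′} √(p*)`, fixing `i` and `√−d′` -/

/-- An odd prime `p ∣ d` divides `d_K ∈ {−d, −4d}`. [cite: Cox2013, (5.12)] -/
theorem natCast_dvd_discK {p d : ℕ} (h : p ∣ d) : (p : ℤ) ∣ discK d := by
  have h' : (p : ℤ) ∣ (d : ℤ) := Int.natCast_dvd_natCast.mpr h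
  unfold discK
  split_ifs
  · exact h'.neg_right
  · exact (h'.mul_left 4).neg_right

/-- An odd prime dividing `d_K ∈ {−d, −4d}` divides `d`. [cite: Cox2013, (5.12)] -/
theorem dvd_of_natCast_dvd_discK {p d : ℕ} (hp : p.Prime) (hodd : Odd p) (h : (p : ℤ) ∣ discK d) : p ∣ d := by
  unfold discK at h
  split_ifs at h
  · exact Int.natCast_dvd_natCast.mp (dvd_neg.mp h)
  · have h4 : p ∣ 4 * d := by
      have h' : (p : ℤ) ∣ ((4 * d : ℕ) : ℤ) := by rw [dvd_neg] at h; exact_mod_cast h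
      exact Int.natCast_dvd_natCast.mp h'
    have hp2 : ¬ p ∣ 2 := fun h2 => by
      have := (Nat.prime_dvd_prime_iff_eq hp Nat.prime_two).mp h2
      rw [this] at hodd
      exact (Nat.not_odd_iff_even.mpr even_two) hodd
    have hcop : Nat.Coprime p 4 := by
      rw [show (4 : ℕ) = 2 ^ 2 by norm_num]
      exact Nat.Coprime.pow_right 2 ((Nat.Prime.coprime_iff_not_dvd hp).mpr hp2)
    exact hcop.dvd_of_dvd_mul_left h4

/-- `√−d ≠ 0` in `ℍ′_n` for `d ∣ n`. [cite: TianYuanZhang2017, §3.1 (p0011 L60–L64)] -/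
theorem sqrtNeg_ne_zero (D : GenusPointData n) {d : ℕ} (hd : d ∈ n.divisors) : D.sqrtNeg d ≠ 0 := by
  intro h
  have hsq := D.sqrtNeg_sq d hd
  rw [h] at hsq
  have hd0 : (d : D.H) ≠ 0 := by exact_mod_cast (Nat.pos_of_mem_divisors hd).ne'
  apply hd0
  have : ((d : ℕ) : D.H) = -((0 : D.H) ^ 2) := by rw [hsq]; ring
  rw [this]; ring

/-- `i ≠ 0` in `ℍ′_n`. [cite: TianYuanZhang2017, §3.1 (p0011 L60–L64)] -/
theorem im_ne_zero (D : GenusPointData n) : D.im ≠ 0 := by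
  intro h
  have hsq := D.im_sq
  rw [h] at hsq
  norm_num at hsq

/-- `(√(d*))² = d* = χ₄(d)·d` as an integer cast, for an odd divisor `d` (`d* = (−1)^{(d−1)/2} d`).
[cite: TianYuanZhang2017, §2.1 (J725 L11–L16)] [cite: Cox2013, Theorem 6.1] -/
theorem genusRoot_sq_eq_cast (D : GenusPointData n) {d : ℕ} (hd : d ∈ n.divisors) (hodd : Odd d) :
    D.genusRoot d ^ 2 = ((ZMod.χ₄ (d : ZMod 4) * (d : ℤ) : ℤ) : D.H) := by
  have h2 : ¬ d % 2 = 0 := by rw [Nat.odd_iff.mp hodd]; decide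
  rw [D.genusRoot_sq hd hodd, ZMod.χ₄_nat_eq_if_mod_four, if_neg h2]
  split_ifs <;> push_cast <;> ring

/-- **`(d₁d₂)* = d₁* d₂*`** (multiplicativity of `χ₄`): for square-free `e`, `∏_{p ∣ e} p* = e*` with `m* = χ₄(m)·m`.
[cite: Cox2013, Theorem 6.1] -/
theorem prod_chi4_mul_eq {e : ℕ} (he : Squarefree e) :
    ∏ p ∈ e.primeFactors, (ZMod.χ₄ (p : ZMod 4) * (p : ℤ)) = ZMod.χ₄ (e : ZMod 4) * (e : ℤ) := by
  have hprod : ∏ p ∈ e.primeFactors, p = e := Nat.prod_primeFactors_of_squarefree he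
  rw [Finset.prod_mul_distrib, ← map_prod (ZMod.χ₄) (fun p : ℕ => (p : ZMod 4)) e.primeFactors,
    ← Nat.cast_prod, ← Nat.cast_prod, hprod]

/-- **`√(e*) = ±∏_{p ∣ e} √(p*)`** in `ℍ′_n`, squared form: for square-free `n` and an odd divisor `e` of `n`,
`(∏_{p ∣ e} genusRoot p)² = (genusRoot e)²`. [cite: Cox2013, Theorem 6.1 (ii)] [cite: TianYuanZhang2017, §2.1 (J725 L11–L16)] -/
theorem prod_genusRoot_sq (D : GenusPointData n) (hn : Squarefree n) {e : ℕ} (he : e ∈ n.divisors) (hodd : Odd e) :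
    (∏ p ∈ e.primeFactors, D.genusRoot p) ^ 2 = D.genusRoot e ^ 2 := by
  have hen : e ∣ n := Nat.dvd_of_mem_divisors he
  have hn0 : n ≠ 0 := hn.ne_zero
  have hesq : Squarefree e := hn.squarefree_of_dvd hen
  rw [← Finset.prod_pow, D.genusRoot_sq_eq_cast he hodd, ← prod_chi4_mul_eq hesq, Int.cast_prod]
  refine Finset.prod_congr rfl fun p hp => ?_
  have hpd : p ∣ e := Nat.dvd_of_mem_primeFactors hp
  exact D.genusRoot_sq_eq_cast (Nat.mem_divisors.mpr ⟨dvd_trans hpd hen, hn0⟩) (hodd.of_dvd_nat hpd)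

/-- An automorphism of `ℍ′_n` fixing `√(p*)` for every prime `p ∣ e` (`e` an odd divisor of the square-free `n`) fixes
`√(e*) = ±∏_{p ∣ e} √(p*)`. [cite: Cox2013, Theorem 6.1 (ii)] [cite: TianYuanZhang2017, §2.1 (J725 L11–L16)] -/
theorem fix_genusRoot_of_fix_primeFactors (D : GenusPointData n) (hn : Squarefree n) {e : ℕ} (he : e ∈ n.divisors)
    (hodd : Odd e) (γ : D.H ≃ₐ[ℚ] D.H) (h : ∀ p ∈ e.primeFactors, γ (D.genusRoot p) = D.genusRoot p) :
    γ (D.genusRoot e) = D.genusRoot e := by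
  have hfix : γ (∏ p ∈ e.primeFactors, D.genusRoot p) = ∏ p ∈ e.primeFactors, D.genusRoot p := by
    rw [map_prod]
    exact Finset.prod_congr rfl h
  rcases sq_eq_sq_iff_eq_or_eq_neg.mp (D.prod_genusRoot_sq hn he hodd).symm with h1 | h1
  · rw [h1, hfix]
  · rw [h1, map_neg, hfix]

/-- For `d ≡ 1 (mod 4)`, `√(d*) = i·√−d`: an automorphism fixing `√(d*)` and `√−d` fixes `i` (the step «`i ∈ L_n`» for
`n ≡ 5 (mod 8)`). [cite: Cox2013, Theorem 6.1 (ii)] [cite: TianYuanZhang2017, proof of Lemma 3.21 (J759 = p0020 L55–L58)] -/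
theorem fix_im_of_fix_genusRoot (D : GenusPointData n) {d : ℕ} (hd : d ∈ n.divisors) (h1 : d % 4 = 1)
    {γ : D.H ≃ₐ[ℚ] D.H} (hg : γ (D.genusRoot d) = D.genusRoot d) (hs : γ (D.sqrtNeg d) = D.sqrtNeg d) :
    γ D.im = D.im := by
  have hgr : D.genusRoot d = D.im * D.sqrtNeg d := by unfold genusRoot; rw [if_pos h1]
  rw [hgr, map_mul, hs] at hg
  exact mul_right_cancel₀ (D.sqrtNeg_ne_zero hd) hg

/-- An automorphism fixing `i` and `√(d′*) ∈ {i·√−d′, √−d′}` fixes `√−d′`.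
[cite: TianYuanZhang2017, §2.1 (J725 L11–L16) and proof of Lemma 3.21 (J759 = p0020 L55–L58)] -/
theorem fix_sqrtNeg_of_fix_genusRoot (D : GenusPointData n) {d : ℕ} {γ : D.H ≃ₐ[ℚ] D.H} (hi : γ D.im = D.im)
    (hg : γ (D.genusRoot d) = D.genusRoot d) : γ (D.sqrtNeg d) = D.sqrtNeg d := by
  unfold genusRoot at hg
  split_ifs at hg with h1
  · rw [map_mul, hi] at hg
    exact mul_left_cancel₀ D.im_ne_zero hg
  · exact hg

/-! ## §2 The kernel content: the five conjuncts are theorems of the printed sentences -/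

namespace ClassFieldData

variable {D : GenusPointData n} (C : D.ClassFieldData)

/-- **What an automorphism fixing the genus field `L_d` fixes** (Theorem 6.1 (ii) read left to right, with
`√(d′*) = ±∏ √(p*)`): `√−d` and `√(d′*)` for every odd divisor `d′` of `d`.
[cite: Cox2013, Theorem 6.1 (ii)] [cite: TianYuanZhang2017, §2.1 (J725 L11–L16), proof of Lemma 3.21 (J759 L25)] -/
theorem fixes_of_mem_ΓL (hn : Squarefree n) {d : ℕ} (hd : d ∈ n.divisors) (hGF : C.genusFieldIs)
    (h61 : C.coxThm61ii) {γ : D.H ≃ₐ[ℚ] D.H} (hγ : γ ∈ C.ΓL d) :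
    γ (D.sqrtNeg d) = D.sqrtNeg d ∧ ∀ d' ∈ d.divisors, Odd d' → γ (D.genusRoot d') = D.genusRoot d' := by
  obtain ⟨hs, hp⟩ := (h61 d hd (C.ΓL d) (hGF d hd) γ).mp hγ
  refine ⟨hs, fun d' hd' hodd' => ?_⟩
  have hd'd : d' ∣ d := Nat.dvd_of_mem_divisors hd'
  have hd'n : d' ∈ n.divisors :=
    Nat.mem_divisors.mpr ⟨dvd_trans hd'd (Nat.dvd_of_mem_divisors hd), hn.ne_zero⟩
  refine D.fix_genusRoot_of_fix_primeFactors hn hd'n hodd' γ fun p hpm => ?_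
  have hpP : p.Prime := Nat.prime_of_mem_primeFactors hpm
  have hpd' : p ∣ d' := Nat.dvd_of_mem_primeFactors hpm
  exact hp p hpP (hodd'.of_dvd_nat hpd') (natCast_dvd_discK (dvd_trans hpd' hd'd))

/-- **A block `d ≡ 5, 6 (mod 8)`: the printed class-field sentences imply `CMBlockSpec`** — (G2 at `d ≡ 5`) and (G4b) by
Theorem 6.1 (ii), (G3b) and (G5a) by Theorem 9.18 at `L = H′_d` (Abelian over `K_d`, contained in the ring class field
of conductor `4`) and `c² = 1`.
[cite: TianYuanZhang2017, §3.1 (J738–J739), Prop. 3.2 (1)(2), Thm. 3.6 (1)(2) (J741), proof of Lemma 3.21 (J759)]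
[cite: Cox2013, Theorem 6.1 (ii), Theorem 9.18, Lemma 9.3] -/
theorem cmBlockSpec_of_classFieldSpec (hn : Squarefree n) {d : ℕ} (hd : d ∈ n.divisors)
    (hd56 : d % 8 = 5 ∨ d % 8 = 6) {z : APoint D.H} {Φ : Finset (D.H ≃ₐ[ℚ] D.H)}
    {ΓH ΓH' : Subgroup (D.H ≃ₐ[ℚ] D.H)} {σ c : D.H ≃ₐ[ℚ] D.H} (hc : D.ConjSpec c) (hCox : C.CoxDisplays c)
    (hB : C.CMBlockClassFieldSpec d z Φ ΓH ΓH' σ c) : D.CMBlockSpec d z Φ ΓH ΓH' σ c := by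
  obtain ⟨hGF, h61, h918⟩ := hCox
  obtain ⟨hG1, ⟨hG2five, hG2six⟩, ⟨hG3a, hG3c⟩, ⟨hG4a, hLH⟩, ⟨hG5b, hG5c⟩, hG6, hG7, hR⟩ := hB
  -- genus theory on H_d ⊃ L_d
  have hGenus : ∀ γ ∈ ΓH, D.FixesGenusField d γ := fun γ hγ => by
    obtain ⟨hs, hg⟩ := C.fixes_of_mem_ΓL hn hd hGF h61 (hLH γ hγ)
    exact ⟨hs, fun d' hd' hodd' _ => hg d' hd' hodd'⟩
  -- K_d ⊂ H′_d, and Theorem 9.18 at L = H′_d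
  have hH'K : ∀ γ ∈ ΓH', γ (D.sqrtNeg d) = D.sqrtNeg d := fun γ hγ => (hGenus γ (hG4a γ hγ)).1
  obtain ⟨-, -, hnormal, hinv⟩ := h918 d hd ΓH' hH'K hG3c hR
  have hcinv : c⁻¹ = c := (mul_eq_one_iff_eq_inv.mp hc.2.2).symm
  refine ⟨hG1, ?_, ⟨hG3a, hnormal, hG3c⟩, ⟨hG4a, hGenus⟩, ⟨fun t ht => ?_, hG5b, hG5c⟩, hG6, hG7⟩
  · -- (G2)
    rcases hd56 with h5 | h6
    · intro t ht
      obtain ⟨hs, hg⟩ := C.fixes_of_mem_ΓL hn hd hGF h61 (hG2five h5 t ht)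
      have hd0 : d ≠ 0 := fun h => by simp [h] at h5
      have hdodd : Odd d := Nat.odd_iff.mpr (by omega)
      have hti : t D.im = D.im :=
        D.fix_im_of_fix_genusRoot hd (by omega) (hg d (Nat.mem_divisors_self d hd0) hdodd) hs
      refine ⟨hti, fun d' hd' _ => ?_⟩
      exact D.fix_sqrtNeg_of_fix_genusRoot hti (hg d' hd' (hdodd.of_dvd_nat (Nat.dvd_of_mem_divisors hd')))
    · exact hG2six h6
  · -- (G5a): c t c⁻¹ t ∈ Gal(ℍ′_n/H′_d) with c⁻¹ = c
    have h := hinv t ht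
    rwa [hcinv] at h

/-- **A block `d ≡ 7 (mod 8)`: «`Z(n)` is already defined over `L_n`» with the genus field named implies `SevenBlockSpec`**
(Theorem 6.1 (ii) read right to left: an automorphism fixing `√−d` and every `√(d′*)` fixes the genus field `L_d`).
[cite: TianYuanZhang2017, Prop. 3.2 (3), proof of Lemma 3.21 (J759 L73–L75)] [cite: Cox2013, Theorem 6.1 (ii)] -/
theorem sevenBlockSpec_of_classFieldSpec {d : ℕ} (hd : d ∈ n.divisors) (hd7 : d % 8 = 7) (hGF : C.genusFieldIs)
    (h61 : C.coxThm61ii) (h7 : C.SevenBlockClassFieldSpec d) : D.SevenBlockSpec d := by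
  intro g hg
  obtain ⟨hs, hgr⟩ := hg
  apply h7 g
  rw [h61 d hd (C.ΓL d) (hGF d hd) g]
  refine ⟨hs, fun p hp hpodd hpdvd => ?_⟩
  have hpd : p ∣ d := dvd_of_natCast_dvd_discK hp hpodd hpdvd
  have hd0 : d ≠ 0 := fun h => by simp [h] at hd7
  exact hgr p (Nat.mem_divisors.mpr ⟨hpd, hd0⟩) hpodd hp.one_lt

end ClassFieldData

/-- **THE SPLIT IS CONSERVATIVE**: for square-free `n`, the layer with the class-field sentences printed implies the layer
of `CMPointGaloisDisplays` — the five conjuncts (G2 at `d ≡ 5`), (G3b), (G4b), (G5a), (G9) are KERNEL THEOREMS of the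
quoted sentences of [TianYuanZhang2017] Prop. 3.2 (1)(2) / p. 759 and Cox's Theorems 6.1 (ii) / 9.18.
[cite: TianYuanZhang2017, §3.1 (J738–J739), Prop. 3.2 (1)(2)(3), Thm. 3.6 (1)(2) (J741), proof of Lemma 3.21 (J759)]
[cite: Cox2013, Theorem 6.1 (ii) and Theorem 9.18] -/
theorem cmPointGaloisPrinted_of_classFieldPrinted (D : GenusPointData n) (hn : Squarefree n)
    (h : D.CMPointClassFieldPrinted) : D.CMPointGaloisPrinted := by
  obtain ⟨C, z, Φ, ΓH, ΓH', σ, θ, c, hc, hCox, hblk⟩ := h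
  refine ⟨z, Φ, ΓH, ΓH', σ, θ, c, hc, fun d hd => ?_⟩
  obtain ⟨h56, h6, h7⟩ := hblk d hd
  exact ⟨fun hd56 => C.cmBlockSpec_of_classFieldSpec hn hd hd56 hc hCox (h56 hd56), h6,
    fun hd7 => C.sevenBlockSpec_of_classFieldSpec hd hd7 hCox.1 hCox.2.1 (h7 hd7)⟩

end GenusPointData

/-! ## §3 The named facts -/

/-- `tyz_cmPointClassFieldData` implies `tyz_cmPointGaloisData` (the five class-field conjuncts are kernel theorems of the
printed sentences). [cite: TianYuanZhang2017, §3] [cite: Cox2013, Theorem 6.1 (ii) and Theorem 9.18] -/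
theorem tyz_cmPointGaloisData_of_cmPointClassFieldData (h : tyz_cmPointClassFieldData) :
    tyz_cmPointGaloisData := by
  intro n hn h8
  obtain ⟨D, hD, hC⟩ := h n hn h8
  exact ⟨D, hD, D.cmPointGaloisPrinted_of_classFieldPrinted hn hC⟩

/-- `tyz_cmPointClassFieldData` implies `tyz_genusPointData`. [cite: TianYuanZhang2017, §3] -/
theorem tyz_genusPointData_of_cmPointClassFieldData (h : tyz_cmPointClassFieldData) : tyz_genusPointData :=
  tyz_genusPointData_of_cmPointGaloisData (tyz_cmPointGaloisData_of_cmPointClassFieldData h)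

end Literature.NumberTheory.EllipticCurves.TianYuanZhang2017

end
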